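import Summits.AtomisticToContinuum.Crystallization.Theorems.ChartedZeroExcessLayeredLatticeLiouvilleYK

/-!
# Charted zero-excess layered-lattice Liouville — YL «TubeRigidity»: (QC) is local UNIQUENESS of clamped equilibria; (QU) ⟸ (QH) for any cN > 3/500 (lens-2 g66, addendum 2)

Second addendum to node g66 «SecantLadder + NearFarShellSplit» (docket `stmt-AtomisticToContinuum-26636`), the CONSEQUENCE of part YK's free criticality of the
core.  Both ends of a matched segment — the mild core `xf` (part YK, from `IsNash ∈ IsDoorSetP`) and the tame filling `y` (binder) — are clamped-critical, so the
docket's leaf (QC) `MildClampedConvexityP … κ …` compares two nearby CRITICAL POINTS of one clamped energy, and part YI's variational glue uses it for exactly one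
thing: to force `y = xf`.  This file types that purpose as a statement and re-hangs the ladder on it.  Imports part YK only; lands after YK.

* **YL-1 (PROVED)** `segConf_one_sub` (reversing the parameter swaps the endpoints) and `le_secondDiff_reverse_of_deriv2_floor` (a Hessian floor `g″ ≥ m` on `[0,1]`
  bounds the second differences anchored at the FAR end as well: YJ-A's lemma applied to `τ ↦ g (1 − τ)`).
* **YL-2 (QU) «TubeCriticalUniquenessP ϑ ϑp q ρ rm dm aHi Λ θ s»** := the binders of (QC) VERBATIM ⟹ `y = xf` — LOCAL UNIQUENESS OF CLAMPED EQUILIBRIA IN THE TAME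
  TUBE, dial-free in `κ`; `(QU) ⇒ (QS)(κ)` for EVERY `κ` PROVED (`mildSecantFloorP_of_uniqueness`; with part YJ's `(QS)(κ) ⇒ (QC)(κ)` this is `(QU) ⇒ (QC)(κ)` ∀ κ).
* **YL-3 (PROVED)** `tubeCriticalUniquenessP_of_hessianFloor`: (QH)(cN) ∧ (TM)(R, Rc, T) ∧ `24·T < cN` ⇒ (QU) (`q + ρ + dm ≤ Rc`, `Rc + 1 ≤ R`) — the near Hessian
  floor bounds the second differences anchored at `y` AND at `xf`, the far part drifts by `≤ 12T·t²·Σ dist²` either way (YJ-B, symmetric), and the two critical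
  ends integrate the floors to `E y + κΣ ≤ E xf` and `E xf + κΣ ≤ E y` with `κ = cN − 24T > 0`, so `Σ dist² = 0`.  RECORD: `tubeCriticalUniqueness_record` —
  (QU)(tameRadius, 1/10, 4, 16, 16, 1/2, 1, 2, 1/16, 1/50) ⟸ (QH)(cN) for ANY `cN > 3/500` — and `mildSecantFloorP_record_of_hessianFloor` — (QS)(κ) at the record
  for EVERY `κ` ⟸ (QH)(cN > 3/500): the threshold bookkeeping `κ ≤ cN − 3/500` of part YJ DISAPPEARS (the docket's (QC)(κ) follows from any positive near-floor
  margin over the PROVED tail `3/500`).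
* DISCHARGE TREE beneath (QC) after this file: (QC)(κ) ⟸ (QS)(κ) [YJ, PROVED] ⟸ (QU) [this file, PROVED] ⟸ (QH)(cN > 3/500) [this file + (TM) PROVED] — the
  ONLY open statement is the near Hessian floor (QH)(cN), cN > 3/500, on Nash-relaxed mild cores (part YK), or (QU) itself for a non-spectral proof.
-/

noncomputable section

open scoped BigOperators Classical
open Set Metric Filter Topology
open Summit.AtomisticToContinuum.Crystallization.Theorems.ChartedPlanarOrderRigidityDoor (E3)
open Summit.AtomisticToContinuum.Crystallization.Theorems.ChartedPlanarOrderDensityDichotomy (μS IsSep)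
open Summit.AtomisticToContinuum.Crystallization.Theorems.ChartedPlanarOrderCleanScaleP (IsCleanP IsDoorSetP)
open Summit.AtomisticToContinuum.Crystallization.Theorems.ChartedPlanarOrderMesoCut (LayeredHom)
open Summit.AtomisticToContinuum.Crystallization.Theorems.ChartedPlanarOrderDoorLayeredOsc (IsTwoShellAffineGood)
open Literature.MathematicalPhysics.StatisticalMechanics (lennardJones interactionEnergy)

namespace Summit.AtomisticToContinuum.Crystallization.Theorems.ChartedZeroExcessLayeredLatticeLiouville

/-! ## Part YL «TubeRigidity» (lens-2 g66, addendum 2): both ends of a matched segment are critical, so a two-sided floor forces them to COINCIDE -/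

section TubeRigidity

/-! ### YL-1  Reversing a matched segment (PROVED) -/

/-- reversing the parameter of a matched segment swaps its endpoints: `segConf y xf (1 − τ) = segConf xf y τ`. [this file, g66] -/
theorem segConf_one_sub {n : ℕ} (y xf : Fin n → E3) (τ : ℝ) : segConf y xf (1 - τ) = segConf xf y τ := by
  funext i
  simp only [segConf, sub_smul, one_smul, smul_sub]
  abel

/-- ★ **HESSIAN FLOOR ⇒ SECANT FLOOR AT THE FAR ANCHOR (PROVED).**  If `g` is twice differentiable on `[0,1]` with `g″ ≥ m`, then the second differences of the
REVERSED function `τ ↦ g (1 − τ)` (anchored at `g 1`) obey the same floor `m·t²/4` for `t ∈ (0,1]` — part YJ-A's `le_secondDiff_of_deriv2_floor` applied to the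
reversed function, whose second derivative is `g″ (1 − τ) ≥ m`. [this file, g66] -/
theorem le_secondDiff_reverse_of_deriv2_floor {g g' g'' : ℝ → ℝ} {m t : ℝ}
    (hg : ∀ τ : ℝ, 0 ≤ τ → τ ≤ 1 → HasDerivAt g (g' τ) τ) (hg' : ∀ τ : ℝ, 0 ≤ τ → τ ≤ 1 → HasDerivAt g' (g'' τ) τ)
    (hm : ∀ τ : ℝ, 0 ≤ τ → τ ≤ 1 → m ≤ g'' τ) (ht : 0 < t) (ht1 : t ≤ 1) :
    m * t ^ 2 / 4 ≤ secondDiff (fun τ => g (1 - τ)) t := by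
  have hsub : ∀ τ : ℝ, HasDerivAt (fun τ' : ℝ => 1 - τ') (-1) τ := fun τ => by
    simpa using (hasDerivAt_id τ).const_sub (1 : ℝ)
  have hG : ∀ τ : ℝ, 0 ≤ τ → τ ≤ 1 → HasDerivAt (fun τ' : ℝ => g (1 - τ')) ((fun τ' : ℝ => -g' (1 - τ')) τ) τ := by
    intro τ h0 h1
    have h := (hg (1 - τ) (by linarith) (by linarith)).comp τ (hsub τ)
    simpa [Function.comp_def] using h
  have hG' : ∀ τ : ℝ, 0 ≤ τ → τ ≤ 1 → HasDerivAt (fun τ' : ℝ => -g' (1 - τ')) ((fun τ' : ℝ => g'' (1 - τ')) τ) τ := by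
    intro τ h0 h1
    have h := ((hg' (1 - τ) (by linarith) (by linarith)).comp τ (hsub τ)).neg
    simpa [Function.comp_def, Pi.neg_def] using h
  exact le_secondDiff_of_deriv2_floor hG hG' (fun τ h0 h1 => hm (1 - τ) (by linarith) (by linarith)) ht ht1

/-! ### YL-2  (QU) the tube-uniqueness statement -/

/-- ★★★ **(QU) «TubeCriticalUniquenessP ϑ ϑp q ρ rm dm aHi Λ θ s» — LOCAL UNIQUENESS OF CLAMPED EQUILIBRIA IN THE TAME TUBE (dial-free reformulation of (QC)).**
The binders of (QC) VERBATIM (θ-good `aHi`-door set `S` with summable pair sums, equilibrium chart, centre, container, `ϑp`-tame `rm`-core, injective enumeration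
`xf` of the `ρ`-core, a filling `y` of the same count matched within `dm`, injective, off the exterior, CLAMPED-CRITICAL and `ϑ`-tame at every site); conclusion:
`y = xf`.  WHY THIS IS THE RIGHT STATEMENT: by part YK the core `xf` is ITSELF clamped-critical (door sets are single-site Nash), so (QC)'s inequality
`E(y) + κ·Σ dist² ≤ E(xf)` compares TWO nearby critical points of the same clamped energy, and the docket (part YI `mildCoolMoatClampedCoreP_of_slavedFilling_convexity`)
uses (QC) for one purpose only — to force the slaved tame critical filling of (QE) to BE the core (`Σ dist² ≤ 0` against grand clamped minimality).  (QU) says that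
directly and for free in `κ`: `(QU) ⇒ (QS)(κ)` for EVERY `κ` (`mildSecantFloorP_of_uniqueness`, hence `(QU) ⇒ (QC)(κ)` for every `κ` through part YJ), and
`(QU) ⟸ (QH)(cN) ∧ (TM)(T)` whenever `cN > 24·T` (`tubeCriticalUniquenessP_of_hessianFloor`: the Hessian floor bounds the second differences anchored at BOTH ends,
criticality of `y` (binder) and of `xf` (part YK) integrate them to `E(y) + κΣ ≤ E(xf)` AND `E(xf) + κΣ ≤ E(y)` with `κ = cN − 24T > 0`, so `Σ dist² = 0`); at the
record `(QU) ⟸ (QH)(cN)` for ANY `cN > 3/500` (`tubeCriticalUniqueness_record`) — the threshold bookkeeping `cN − 3/500 ≥ κ` of part YJ disappears.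
ANALYTIC · LOCAL · FINITE-DIMENSIONAL modulo the PROVED tail · UNDECIDED · TRUE-type-expected exactly when the clamped energy is non-degenerate (no second tame
equilibrium) in the `dm`-tube about Nash-relaxed mild cores — the Born bet of (QC)/(QSⁿ)/(QH) in its cleanest form · CERT-able via (QH) · INSTRUMENTABLE («MildBorn(ϑp)»
restricted to Nash-relaxed members, CRITIC-LEDGER row 1208 (c⁗) as amended by part YK).
Why it might fail: a mild (`ϑp = 1/10`) Nash-relaxed clamped core admitting a SECOND `ϑ`-tame clamped equilibrium within `dm = 1/2` sitewise (a soft collective mode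
of the strained patch crossing zero: bifurcation of clamped equilibria below the tameness limit) refutes (QU)(1/10) and forces the amplitude dial `ϑp ↓` (part YG).
Sources: part YI ((QC), the variational glue); part YK (free criticality of the core); parts YJ-A/B/C ((QS), (QH), (TM)); E–Ming, Arch. Ration. Mech. Anal. 183 (2007)
241 §2; Ortner–Theil, Arch. Ration. Mech. Anal. 207 (2013) 1025 (local uniqueness of atomistic equilibria near Cauchy–Born states). [this file, g66] -/
def TubeCriticalUniquenessP (ϑ ϑp q ρ rm dm aHi Λ θ s : ℝ) : Prop :=
  ∀ δ : ℝ, 0 < δ → ∀ a : ℝ, 0 < a →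
    ∀ S : Set E3, IsDoorSetP aHi δ S → (∀ z : E3, Summable fun y : S => lennardJones (dist z (y : E3))) →
      (∀ p ∈ S, IsTwoShellAffineGood θ S p) →
        ∀ (L : E3 ≃L[ℝ] E3) (w : ℤ → E3), IsEquilChart a s Λ L w →
          ∀ (x₀ : E3) (K : Set E3), K ⊆ S → (∀ k ∈ K, dist k x₀ ≤ q) →
            IsTameOn ϑp S (LayeredHom (L : E3 →L[ℝ] E3) w) (coreOf S K rm) →
              ∀ (n : ℕ) (xf : Fin n → E3), Function.Injective xf → Set.range xf = coreOf S K ρ →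
                ∀ y : Fin n → E3, (∀ i, dist (xf i) (y i) ≤ dm) → Function.Injective y → Disjoint (Set.range y) (S \ coreOf S K ρ) →
                  HasFDerivAt (fun z : Fin n → E3 => clampedEnergy (S \ coreOf S K ρ) z) (0 : (Fin n → E3) →L[ℝ] ℝ) y →
                    (∀ i, IsTameStar ϑ ((S \ coreOf S K ρ) ∪ Set.range y) (LayeredHom (L : E3 →L[ℝ] E3) w) (y i)) →
                      y = xf

/-- ★★ **(QU) ⇒ (QS)(κ) FOR EVERY `κ` (PROVED)** — along the degenerate segment `y = xf` every second difference vanishes and so does `Σ dist²`. [this file, g66] -/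
theorem mildSecantFloorP_of_uniqueness {ϑ ϑp q ρ rm dm aHi Λ θ s : ℝ} (κ : ℝ) (hU : TubeCriticalUniquenessP ϑ ϑp q ρ rm dm aHi Λ θ s) :
    MildSecantFloorP ϑ ϑp q ρ rm dm κ aHi Λ θ s := by
  intro δ hδ a ha S hS hsum hgood L w hLw x₀ K hKS hKq hmild n xf hxf hrange y hnear hyinj hydisj hcrit htame t ht ht1
  have hyx : y = xf := hU δ hδ a ha S hS hsum hgood L w hLw x₀ K hKS hKq hmild n xf hxf hrange y hnear hyinj hydisj hcrit htame
  have hseg : ∀ τ : ℝ, segConf y xf τ = xf := fun τ => by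
    funext i
    simp [segConf, hyx]
  have h0 : ∑ i, dist (xf i) (y i) ^ 2 = 0 := by simp [hyx]
  rw [h0, mul_zero]
  simp only [secondDiff, hseg]
  linarith

/-! ### YL-3  (QU) ⟸ (QH) ∧ (TM): two-anchored floors and the free criticality of the core (PROVED) -/

/-- ★★★ **(QH)(cN) ∧ (TM)(R, Rc, T) ∧ `24·T < cN` ⇒ (QU) (PROVED)** for `q + ρ + dm ≤ Rc`, `Rc + 1 ≤ R`.  The near Hessian floor `g″ ≥ 2cN·Σ dist²` on `[0,1]`
bounds the second differences of the near energy anchored at `y` (part YJ-A) AND at `xf` (`le_secondDiff_reverse_of_deriv2_floor`, `segConf_one_sub`); the far part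
drifts by at most `12T·t²·Σ dist²` along either parametrisation (part YJ-B `abs_secondDiff_farClampedEnergy_le`, symmetric in the endpoints); criticality of `y`
(binder) and of `xf` (part YK `hasFDerivAt_clampedEnergy_core`) turn the two floors into `E y + κΣ ≤ E xf` and `E xf + κΣ ≤ E y` with `κ = cN − 24T > 0`
(part YJ-A `add_mul_sum_sq_le_of_secondDiff_floor`), whence `Σᵢ dist(xf i, y i)² = 0` and `y = xf`. [this file, g66] -/
theorem tubeCriticalUniquenessP_of_hessianFloor {ϑ ϑp q ρ rm dm R Rc T cN aHi Λ θ s : ℝ}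
    (hRc : q + ρ + dm ≤ Rc) (hR : Rc + 1 ≤ R) (hTM : DoorTailMomentP aHi R Rc T) (hcN : 24 * T < cN)
    (hN : NearHessianFloorP ϑ ϑp q ρ rm dm R cN aHi Λ θ s) : TubeCriticalUniquenessP ϑ ϑp q ρ rm dm aHi Λ θ s := by
  intro δ hδ a ha S hS hsum hgood L w hLw x₀ K hKS hKq hmild n xf hxf hrange y hnear hyinj hydisj hcrit htame
  obtain ⟨g₁, g₂, hg, hg', hm⟩ := hN δ hδ a ha S hS hsum hgood L w hLw x₀ K hKS hKq hmild n xf hxf hrange y hnear hyinj hydisj hcrit htame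
  have hcritx : HasFDerivAt (fun z : Fin n → E3 => clampedEnergy (S \ coreOf S K ρ) z) (0 : (Fin n → E3) →L[ℝ] ℝ) xf :=
    hasFDerivAt_clampedEnergy_core hδ hS hsum hxf hrange
  set X : Set E3 := S \ coreOf S K ρ with hX
  have hXS : X ⊆ S := fun p hp => hp.1
  obtain ⟨hTs, hT⟩ := hTM δ hδ S hS X hXS x₀
  -- both families lie in `B̄(x₀, Rc)`
  have hxf0 : ∀ i, dist (xf i) x₀ ≤ Rc := by
    intro i
    have hdm : 0 ≤ dm := le_trans dist_nonneg (hnear i)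
    have hi : xf i ∈ coreOf S K ρ := hrange ▸ Set.mem_range_self i
    obtain ⟨_, k, hk, hik⟩ := hi
    linarith [dist_triangle (xf i) k x₀, hKq k hk]
  have hy0 : ∀ i, dist (y i) x₀ ≤ Rc := by
    intro i
    have hi : xf i ∈ coreOf S K ρ := hrange ▸ Set.mem_range_self i
    obtain ⟨_, k, hk, hik⟩ := hi
    linarith [dist_triangle (y i) (xf i) x₀, dist_triangle (xf i) k x₀, hKq k hk, hnear i, dist_comm (xf i) (y i)]
  -- the near/far split along any segment of families
  have hsplit : ∀ u v : Fin n → E3, (fun τ => clampedEnergy X (segConf u v τ))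
      = fun τ => nearClampedEnergy X x₀ R (segConf u v τ) + farClampedEnergy X x₀ R (segConf u v τ) := by
    intro u v
    funext τ
    exact clampedEnergy_eq_near_add_far X x₀ R (segConf u v τ)
      (fun i => summable_coe_subset hXS (f := fun p => lennardJones (dist (segConf u v τ i) p)) (hsum _))
  set D : ℝ := ∑ i, dist (xf i) (y i) ^ 2 with hD
  have hD' : ∑ i, dist (y i) (xf i) ^ 2 = D := Finset.sum_congr rfl fun i _ => by rw [dist_comm]
  have hDnn : 0 ≤ D := Finset.sum_nonneg fun i _ => by positivity
  -- floor anchored at `y`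
  have hfl₁ : ∀ t : ℝ, 0 < t → t ≤ 1 →
      (cN - 24 * T) / 2 * t ^ 2 * ∑ i, dist (xf i) (y i) ^ 2 ≤ secondDiff (fun τ => clampedEnergy X (segConf y xf τ)) t := by
    intro t ht ht1
    have h1 := le_secondDiff_of_deriv2_floor hg hg' hm ht ht1
    have h2 := (abs_le.1 (abs_secondDiff_farClampedEnergy_le hXS x₀ hR hsum hTs hT hy0 hxf0 ht ht1)).1
    rw [hsplit, secondDiff_add]
    have hs : 0 ≤ t ^ 2 * D := mul_nonneg (by positivity) hDnn
    nlinarith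
  -- floor anchored at `xf` (the reversed segment)
  have hfl₂ : ∀ t : ℝ, 0 < t → t ≤ 1 →
      (cN - 24 * T) / 2 * t ^ 2 * ∑ i, dist (y i) (xf i) ^ 2 ≤ secondDiff (fun τ => clampedEnergy X (segConf xf y τ)) t := by
    intro t ht ht1
    have h1 := le_secondDiff_reverse_of_deriv2_floor hg hg' hm ht ht1
    have e1 : (fun τ : ℝ => nearClampedEnergy X x₀ R (segConf y xf (1 - τ))) = fun τ => nearClampedEnergy X x₀ R (segConf xf y τ) := by
      funext τ
      rw [segConf_one_sub]
    rw [e1] at h1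
    have h2 := (abs_le.1 (abs_secondDiff_farClampedEnergy_le hXS x₀ hR hsum hTs hT hxf0 hy0 ht ht1)).1
    rw [hD'] at h2
    rw [hsplit, secondDiff_add, hD']
    have hs : 0 ≤ t ^ 2 * D := mul_nonneg (by positivity) hDnn
    nlinarith
  -- integrate both floors against the two critical ends
  have hA := add_mul_sum_sq_le_of_secondDiff_floor (E := fun z : Fin n → E3 => clampedEnergy X z) (κ := cN - 24 * T) hcrit hfl₁
  have hB := add_mul_sum_sq_le_of_secondDiff_floor (E := fun z : Fin n → E3 => clampedEnergy X z) (κ := cN - 24 * T) hcritx hfl₂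
  rw [hD'] at hB
  have hκ : 0 < cN - 24 * T := by linarith
  have hDle : D ≤ 0 :=
    le_of_mul_le_mul_left (by linarith : (cN - 24 * T) * D ≤ (cN - 24 * T) * 0) hκ
  have hzero : ∀ i, dist (xf i) (y i) ^ 2 = 0 := fun i =>
    (Finset.sum_eq_zero_iff_of_nonneg fun j _ => by positivity).1 (le_antisymm hDle hDnn) i (Finset.mem_univ i)
  exact funext fun i => (dist_eq_zero.1 (pow_eq_zero_iff two_ne_zero |>.1 (hzero i))).symm

/-- ★★★ **THE RECORD: (QU) at the docket's geometry ⟸ (QH)(cN) for ANY `cN > 3/500` (PROVED)** — `tubeCriticalUniquenessP_of_hessianFloor` with the PROVED tail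
moment `doorTailMomentP_record : DoorTailMomentP 1 41 (41/2) (1/4000)` (`24·T = 3/500`, `q + ρ + dm = 4 + 16 + 1/2 = 41/2`). [this file, g66] -/
theorem tubeCriticalUniqueness_record {cN : ℝ} (hcN : 3 / 500 < cN)
    (hN : NearHessianFloorP tameRadius (1 / 10) 4 16 16 (1 / 2) 41 cN 1 2 (1 / 16) (1 / 50)) :
    TubeCriticalUniquenessP tameRadius (1 / 10) 4 16 16 (1 / 2) 1 2 (1 / 16) (1 / 50) :=
  tubeCriticalUniquenessP_of_hessianFloor (Rc := 41 / 2) (T := 1 / 4000) (by norm_num) (by norm_num) doorTailMomentP_record (by linarith) hN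

/-- ★★ **THE RECORD, SECANT FORM: (QS)(κ) at the docket's geometry for EVERY `κ` ⟸ (QH)(cN) for ANY `cN > 3/500` (PROVED)** — so, through part YJ's
`(QS)(κ) ⇒ (QC)(κ)`, the docket's (QC)(κ) follows from the near Hessian floor with NO threshold bookkeeping between `κ` and `cN`. [this file, g66] -/
theorem mildSecantFloorP_record_of_hessianFloor (κ : ℝ) {cN : ℝ} (hcN : 3 / 500 < cN)
    (hN : NearHessianFloorP tameRadius (1 / 10) 4 16 16 (1 / 2) 41 cN 1 2 (1 / 16) (1 / 50)) :
    MildSecantFloorP tameRadius (1 / 10) 4 16 16 (1 / 2) κ 1 2 (1 / 16) (1 / 50) :=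
  mildSecantFloorP_of_uniqueness κ (tubeCriticalUniqueness_record hcN hN)

end TubeRigidity

end Summit.AtomisticToContinuum.Crystallization.Theorems.ChartedZeroExcessLayeredLatticeLiouville

end
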